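import Summits.ResolutionOfSingularities.ResolutionOfSingularities.Theorems.FrobeniusClosingPatchingRelPerfectDepthWeightTwoBPieceStepOut
import Summits.ResolutionOfSingularities.ResolutionOfSingularities.Theorems.FrobeniusClosingPatchingRelPerfectDepthMixedTargetsJR
import Literature.AlgebraicGeometry.Resolution.CartierDivisorControlledTransformReduced
import Literature.AlgebraicGeometry.Resolution.NormalCrossingsStrictification
import Literature.AlgebraicGeometry.Resolution.BlowupsIntegral
import HarnessLib

/-!
# Crux `PatchingRelPerfect` (stmt-ResolutionOfSingularities-16161), chain W5.2 — TargetsF5J(R) T5-E «W₂B-maxweight»: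
# ONE `IsWeightedSeqJR.cons` STEP along one piece, with the transport state re-established

[OURS · L1 W5.2 · TargetsF5J(R) T5-E] Fact-free; NOT statements of the manuscript under review. `piece_cons` packages
`…DepthWeightTwoBPieceStep` (every input clause of `IsWeightedSeqJR.cons` at one piece `Z`: `PieceIn.*`) and `…PieceStepOut`
(the new state `stateIn'`, the host-free clauses, the support of the new host, the centre data of the other pieces transported:
`CentreIn.transport`) with res-type-049's (L-D) `IsBlowup.radical_controlledTransform_eq` (the transported reduced host is reduced)
into the single statement the pieces loop iterates: from `StateIn 𝔟 D ℬ 𝒟` on `W`, a prefix `IsWeightedSeqJR 2 ρ 𝔟₀ 𝔟₀ [] [] 𝔟 D ℬ 𝒟`,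
the centre data of a piece `Z` and a blow-up `τ` of `W` along `𝓘(Z)`: the extended sequence `IsWeightedSeqJR 2 (τ ≫ ρ) …` to the new
state (weight `ν = pieceWeight 𝔟 Z`, host weight `m = ord_η D`), `StateIn` of the new state, `Supp D' = cl τ⁻¹(Supp D ∖ Z)`, the
boundary bound, and the transport of the centre data of every piece disjoint from `Z`.

AI-written; AI review is weaker than expert review.

## References
* E. Bierstone, D. Grigoriev, P. Milman, J. Włodarczyk, arXiv:1206.3090, Def. 3.1.3, §3.2, §4 Step 2. [BierstoneGrigorievMilmanWlodarczyk2011]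
* V. Cossart, U. Jannsen, S. Saito, LNM 2270 (2020), Thm. 1.4, Def. 3.1, Def. 4.1, (6.2). [CossartJannsenSaito2020]
* J. Kollár, *Lectures on Resolution of Singularities* (2007), Def. 3.25, 3.30.2, (3.111) Step 1. [Kollar2007]
-/

-- `Summit.<Summit>.<Sub>.Theorems` with `Sub = Summit` (single-conjunct summit, D-0017)
set_option linter.dupNamespace false

noncomputable section

open CategoryTheory CategoryTheory.Limits AlgebraicGeometry TopologicalSpace IsLocalRing
open Literature.AlgebraicGeometry.Resolution Scheme.IdealSheafData

namespace Summit.ResolutionOfSingularities.ResolutionOfSingularities.Theorems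

universe u

namespace WeightTwoB

open DepthSNC DepthTargets

/-- **ONE WEIGHTED STEP ALONG ONE PIECE, state re-established** (see the module docstring).
[cite: BierstoneGrigorievMilmanWlodarczyk2011, Def. 3.1.3, §4 Step 2a] [cite: CossartJannsenSaito2020, (6.2)]
[cite: Kollar2007, 3.30.2, (3.111) Step 1] -/
theorem piece_cons {E W : Scheme.{u}} [IsIntegral W] [IsNoetherian W] {ρ : W ⟶ E} {𝔟₀ : E.IdealSheafData}
    {𝔟 D : W.IdealSheafData} {ℬ 𝒟 : List (W.IdealSheafData × ℕ)} (S : StateIn 𝔟 D ℬ 𝒟)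
    (hseq : IsWeightedSeqJR 2 ρ 𝔟₀ 𝔟₀ [] [] 𝔟 D ℬ 𝒟) {Z : Closeds W} (Γ : CentreIn D ℬ Z)
    {B₀ : Set W} (hℬB : ∀ p ∈ ℬ, (p.1.support : Set W) ⊆ B₀) (hZB : (Z : Set W) ⊆ B₀)
    {W' : Scheme.{u}} {τ : W' ⟶ W} (hτ : IsBlowup τ (vanishingIdeal Z)) :
    ∃ (_ : IsIntegral W') (_ : IsNoetherian W') (𝔟' D' : W'.IdealSheafData) (ℬ' 𝒟' : List (W'.IdealSheafData × ℕ)),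
      IsWeightedSeqJR 2 (τ ≫ ρ) 𝔟₀ 𝔟₀ [] [] 𝔟' D' ℬ' 𝒟' ∧ StateIn 𝔟' D' ℬ' 𝒟' ∧
      ((D'.support : Set W') = closure (τ ⁻¹' ((D.support : Set W) \ Z))) ∧
      (∀ p ∈ ℬ', (p.1.support : Set W') ⊆ τ ⁻¹' B₀) ∧
      (∀ Z₂ : Closeds W, CentreIn D ℬ Z₂ → Disjoint (Z : Set W) Z₂ → CentreIn D' ℬ' (Z₂.preimage τ.continuous)) := by
  obtain ⟨η, hη⟩ := Γ.exists_isGenericPoint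
  have P := S.pieceIn Γ hη
  obtain ⟨m, hm, hm1⟩ := P.exists_idealOrder_host_eq
  haveI : IsNoetherian W' := isNoetherian_of_isBlowup hτ
  -- the centre ideal is non-zero (the piece has empty interior in the non-empty `W`)
  have hC0 : vanishingIdeal Z ≠ ⊥ := by
    intro h0
    have hint := interior_piece_eq_empty S Γ hη
    have hZ : (Z : Set W) = Set.univ := by
      rw [← Scheme.IdealSheafData.coe_support_vanishingIdeal Z, h0, Scheme.IdealSheafData.support_bot]; rfl
    rw [hZ, interior_univ] at hint
    exact (Set.univ_nonempty (α := W)).ne_empty hint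
  haveI : IsIntegral W' := hτ.isIntegral hC0
  -- the transported host is reduced (res-type-049's (L-D))
  have hrad : controlledTransform τ (vanishingIdeal Z) D m =
      vanishingIdeal (controlledTransform τ (vanishingIdeal Z) D m).support := by
    rw [Scheme.IdealSheafData.vanishingIdeal_support]
    refine (hτ.radical_controlledTransform_eq S.regW Γ.regZ P.gen' (P.subZ P.η_mem) hm S.hostCartier ?_).symm
    rw [← Scheme.IdealSheafData.vanishingIdeal_support]; exact S.hostRad.symm
  refine ⟨inferInstance, inferInstance, _, _, _, _, ?_, stateIn' S Γ hη hτ hm hrad, support_host' S Γ hη hτ hm, ?_,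
    fun Z₂ Γ₂ hd => CentreIn.transport S Γ hτ Γ₂ hd _ hrad⟩
  · -- the `cons` step, clause by clause
    exact IsWeightedSeqJR.cons τ ρ 𝔟₀ 𝔟₀ [] [] 𝔟 D ℬ 𝒟 (vanishingIdeal Z) (pieceWeight 𝔟 (Z : Set W)) m hseq Γ.regZ
      P.isPreconnected (one_le_pieceWeight 𝔟 _) (pieceWeight_le_two 𝔟 _) P.le_pow_weight (P.host_le_pow hm)
      (P.weight_le_add hm hm1) Γ.sncZ P.uniformPieces.1 P.uniformPieces.2
      (fun z hz hreq => P.joint_clause (by rwa [← Scheme.IdealSheafData.coe_support_vanishingIdeal Z]) hreq)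
      (fun hlt z hz => P.maxWeight_clause hlt (by rwa [← Scheme.IdealSheafData.coe_support_vanishingIdeal Z]))
      hτ (not_host'_le_strict S Γ hτ) (not_host'_le_exc S Γ hη hτ hm)
  · -- the boundary bound
    intro p hp
    rcases mem_stepExp_iff.mp hp with ⟨q, hq, rfl⟩ | rfl
    · intro x' hx'
      have h := support_antitone ((comap_le_controlledTransform τ (vanishingIdeal Z) q.1 0).trans
        (controlledTransform_le_strictTransformIdeal τ (vanishingIdeal Z) q.1 0)) hx'
      exact hℬB q hq ((mem_support_comap_iff τ q.1 x').mp h)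
    · intro x' hx'
      have h := (mem_support_comap_iff τ (vanishingIdeal Z) x').mp hx'
      rw [Scheme.IdealSheafData.coe_support_vanishingIdeal] at h
      exact hZB h

end WeightTwoB

end Summit.ResolutionOfSingularities.ResolutionOfSingularities.Theorems

end
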